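import Literature.Topology.FourManifolds.HandleTubeDepthField
import Literature.Topology.FourManifolds.CollarTheorem
import Literature.Topology.FourManifolds.BoundaryLocalMinDerivative
import Literature.Topology.FourManifolds.RegularSlabField
import HarnessLib

/-!
# A flow-out collar of `∂W` adapted to a family of attaching maps of 2-handles

Topic `Literature/Topology/FourManifolds`; infrastructure for the isotopy invariance of
2-handle attachment (`Geometry/Symplectic/TwoHandleIsotopy.lean`, named fact
`HandleAttachingMap.isMultiAttachment_of_linkIsotopyInBoundary`), step *"independence of the
interior extension `h̄` of `h`"* (Kosinski, *Differential Manifolds* (1993), VI §5: the manifold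
joined along submanifolds of the boundary *"depends on the choice of imbeddings `h₁, h₂`, but not
on the choice of extensions `h̄₁, h̄₂` … a version of the Uniqueness of Collars Theorem"*).

**Theorem** (`HandleAttachingMap.exists_adapted_flowout`).  Let `W` be a compact manifold with
boundary of dimension `4` and `f : ι → HandleAttachingMap 3 2 W` a finite family of attaching
maps of 2-handles with pairwise disjoint ranges.  There are flow-out data `D` on `W`
(`FlowoutInput`, `BoundaryFlowout.lean`: a boundary-defining function `f_D`, a vector field `ξ`
with `ξ(f_D) = 1` near `∂W`) and a cover `Γ` (so that the flow-out `Γ.Fl` is Milnor's collar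
`ψ_y(s)`, `BoundaryFlowout.lean`, `FlowoutInput.Cover.openCollarData`) such that **the collar
lines through the sphere part of each `f i` near its attaching circle are the depth lines of
`f i`**: for `‖v‖ ≤ 1/2` and `0 ≤ s ≤ min (1/5) Γ.a`,
`Γ.Fl (f i (depthLine θ v 0)) s = f i (depthLine θ v s)`.

**Construction** (Milnor, *Lectures on the h-cobordism theorem* (1965), proof of Thm. 3.4, with
prescribed germs along the tubes).  Near the cores `f_D` is the depth function `tubeDepth ∘ (f i)⁻¹`
and `ξ` the depth field of `f i` (`HandleTubeDepthField.lean`); elsewhere `f_D` is a reference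
boundary-defining function `f₀` (`nonempty_flowoutInput`, `CollarTheorem.lean`), the two being
blended by cut-offs `ρᵢ` supported in the tubes (`f_D = f₀ + Σ ρᵢ (dᵢ - f₀)`).  At a boundary
point both `f₀` and `dᵢ` have a local minimum and a nonzero differential, so their differentials
are positive multiples of the inward conormal (`BoundaryLocalMinDerivative.lean`) and so is the
blend: `f_D` is regular along `∂W`, hence on a sublevel set `{f_D < δ'}`
(`exists_pos_forall_mfderiv_ne_zero`).  The field `ξ` is glued by a partition of unity from the
depth fields near the cores, local unit fields (`exists_contMDiffOn_section_mlineDeriv_eq_one`,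
`RegularSlabField.lean`) and the zero field, the constraints being affine
(`exists_contMDiffSection_forall_mem_convex_of_local`).  The depth lines are integral curves of
the depth fields (`isMIntegralCurveOn_depthLine`), hence of `ξ`, and the flow-out is the integral
curve (`FlowoutInput.Cover.isMIntegralCurveOn_Fl`, uniqueness `eqOn_of_eq_left`).

Everything here is proved; no definitions of named facts are introduced.

## References

* A. A. Kosinski, *Differential Manifolds*, Academic Press (1993), VI §5. [Kosinski1993]
* J. Milnor, *Lectures on the h-cobordism theorem*, Princeton (1965), proof of Thm. 3.4.
  [MilnorHCobordism1965]
-/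

open scoped Manifold ContDiff Topology
open Set Function Metric Filter

noncomputable section

namespace Literature.Topology.FourManifolds

/-- Local notation: `𝔼 n` is the model Euclidean space `EuclideanSpace ℝ (Fin n)`. -/
local notation "𝔼 " n:arg => EuclideanSpace ℝ (Fin n)

/-- Local notation: `𝕊 n` is the unit sphere in `EuclideanSpace ℝ (Fin (n + 1))`. -/
local notation "𝕊 " n:arg => (Metric.sphere (0 : EuclideanSpace ℝ (Fin (n + 1))) 1)

/-- Local notation: `𝔻 n` is the closed unit ball in `EuclideanSpace ℝ (Fin n)`. -/
local notation "𝔻 " n:arg => (Metric.closedBall (0 : EuclideanSpace ℝ (Fin n)) 1)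

set_option quotPrecheck false in
/-- Local notation: Kosinski's tube `T ⊆ D⁴` of the circle `S¹ × 0`, as a type. -/
local notation "𝕋" => ↥(handleTube 3 2)

namespace HandleAttachingMap

variable {W : Type*} [TopologicalSpace W] [ChartedSpace (EuclideanHalfSpace 4) W]

/-! ### The regions of a tube above a level of `|x_λ|²` -/

section Regions

variable (f : HandleAttachingMap 3 2 W)

/-- The open region `f {y | c < |x_λ|²(y)}` of the tube of `f` near its attaching circle.
[folklore] -/
def tubeRegion (c : ℝ) : Set W := f.toFun '' {y | c < lamSq 2 (tubeVec y)}

/-- The closed region `f {y | c ≤ |x_λ|²(y)}` of the tube of `f` near its attaching circle.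
[folklore] -/
def tubeClosedRegion (c : ℝ) : Set W := f.toFun '' {y | c ≤ lamSq 2 (tubeVec y)}

/-- The open region is open (`f` is an open map). [folklore] -/
theorem isOpen_tubeRegion (c : ℝ) : IsOpen (f.tubeRegion c) :=
  f.isOpenEmbedding.isOpenMap _ ((isOpen_lt continuous_const (continuous_lamSq 2)).preimage
    contMDiff_tubeVec.continuous)

/-- The closed region above a positive level is compact (the image of a compact piece of the
closed ball). [folklore] -/
theorem isCompact_tubeClosedRegion {c : ℝ} (hc : 0 < c) : IsCompact (f.tubeClosedRegion c) := by
  refine IsCompact.image ?_ f.continuous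
  -- `{y ∈ T | c ≤ |x_λ|²}` is homeomorphic to the compact `{u ∈ D⁴ | c ≤ |x_λ|²}`
  have hK : IsCompact {u : 𝔻 4 | c ≤ lamSq 2 (u : 𝔼 4)} :=
    (isClosed_le continuous_const ((continuous_lamSq 2).comp continuous_subtype_val)).isCompact
  have himg : {y : 𝕋 | c ≤ lamSq 2 (tubeVec y)} =
      (Subtype.val : 𝕋 → 𝔻 4) ⁻¹' {u : 𝔻 4 | c ≤ lamSq 2 (u : 𝔼 4)} := rfl
  rw [himg]
  refine Topology.IsInducing.subtypeVal.isCompact_preimage' hK fun u hu => ?_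
  simp only [mem_setOf_eq] at hu
  exact ⟨⟨u, by rw [SetLike.mem_coe, mem_handleTube]; exact (hc.trans_le hu).ne'⟩, rfl⟩

/-- The closed region is closed. [folklore] -/
theorem isClosed_tubeClosedRegion [T2Space W] {c : ℝ} (hc : 0 < c) : IsClosed (f.tubeClosedRegion c) :=
  (f.isCompact_tubeClosedRegion hc).isClosed

/-- Monotonicity: the open region above `c` lies in the closed region above `c`. [folklore] -/
theorem tubeRegion_subset_tubeClosedRegion (c : ℝ) : f.tubeRegion c ⊆ f.tubeClosedRegion c :=
  image_mono fun y (hy : c < lamSq 2 (tubeVec y)) => show c ≤ lamSq 2 (tubeVec y) from le_of_lt hy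

/-- Monotonicity: for `c < c'` the closed region above `c'` lies in the open region above `c`.
[folklore] -/
theorem tubeClosedRegion_subset_tubeRegion {c c' : ℝ} (h : c < c') :
    f.tubeClosedRegion c' ⊆ f.tubeRegion c :=
  image_mono fun y (hy : c' ≤ lamSq 2 (tubeVec y)) => show c < lamSq 2 (tubeVec y) from h.trans_le hy

/-- The regions lie in the range of `f`. [folklore] -/
theorem tubeRegion_subset_range (c : ℝ) : f.tubeRegion c ⊆ range f.toFun :=
  image_subset_range _ _

/-- The closed regions lie in the range of `f`. [folklore] -/
theorem tubeClosedRegion_subset_range (c : ℝ) : f.tubeClosedRegion c ⊆ range f.toFun :=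
  image_subset_range _ _

/-- Membership of `f y` in the open region. [folklore] -/
theorem apply_mem_tubeRegion_iff {c : ℝ} {y : 𝕋} : f.toFun y ∈ f.tubeRegion c ↔ c < lamSq 2 (tubeVec y) := by
  constructor
  · rintro ⟨y', hy', he⟩
    rw [f.injective he] at hy'
    exact hy'
  · exact fun h => ⟨y, h, rfl⟩

/-- Membership of `f y` in the closed region. [folklore] -/
theorem apply_mem_tubeClosedRegion_iff {c : ℝ} {y : 𝕋} :
    f.toFun y ∈ f.tubeClosedRegion c ↔ c ≤ lamSq 2 (tubeVec y) := by
  constructor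
  · rintro ⟨y', hy', he⟩
    rw [f.injective he] at hy'
    exact hy'
  · exact fun h => ⟨y, h, rfl⟩

/-- The depth lines with `‖v‖ ≤ 1/2` and `s ≤ 1/5` run in the closed region above `11/20`.
[folklore] -/
theorem depthLine_mem_tubeClosedRegion (θ : 𝕊 1) {v : 𝔼 2} (hv : ‖v‖ ≤ 1 / 2) {s : ℝ}
    (hs : s ∈ Icc (0 : ℝ) (1 / 5)) : f.toFun (depthLine θ v s) ∈ f.tubeClosedRegion (11 / 20) := by
  rw [apply_mem_tubeClosedRegion_iff]
  have hv2 : ‖v‖ ^ 2 ≤ 1 / 4 := by nlinarith [norm_nonneg v]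
  have h : 0 < 1 - s - ‖v‖ ^ 2 := by linarith [hs.2]
  rw [lamSq_depthLine θ v hs.1 h]
  linarith [hs.2]

end Regions

/-! ### The blended boundary-defining function -/

section Blend

variable [T2Space W] {ι : Type*} (f : ι → HandleAttachingMap 3 2 W)
  (hdisj : Pairwise fun i j => Disjoint (range (f i).toFun) (range (f j).toFun))

/-- **Cut-offs supported in the tubes**: smooth `ρᵢ : W → [0, 1]`, equal to `1` on the closed
region above `13/25` and to `0` off the open region above `51/100` of the tube of `f i`
(Mathlib's `exists_contMDiffMap_zero_one_of_isClosed`). [folklore] -/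
theorem exists_cutoff [IsManifold (𝓡∂ 4) ∞ W] [CompactSpace W] (i : ι) :
    ∃ ρ : W → ℝ, ContMDiff (𝓡∂ 4) 𝓘(ℝ, ℝ) ∞ ρ ∧ (∀ z, ρ z ∈ Icc (0 : ℝ) 1) ∧
      (∀ z ∈ (f i).tubeClosedRegion (13 / 25), ρ z = 1) ∧
      ∀ z, z ∉ (f i).tubeRegion (51 / 100) → ρ z = 0 := by
  haveI : FiniteDimensional ℝ (EuclideanSpace ℝ (Fin 4)) := inferInstance
  obtain ⟨g, hg0, hg1, hg⟩ := exists_contMDiffMap_zero_one_of_isClosed (𝓡∂ 4) (n := (⊤ : ℕ∞))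
    ((f i).isOpen_tubeRegion (51 / 100)).isClosed_compl
    ((f i).isClosed_tubeClosedRegion (by norm_num : (0 : ℝ) < 13 / 25))
    (disjoint_compl_left_iff_subset.2
      ((f i).tubeClosedRegion_subset_tubeRegion (by norm_num : (51 / 100 : ℝ) < 13 / 25)))
  exact ⟨g, g.contMDiff, hg, fun z hz => hg1 hz, fun z hz => hg0 hz⟩

variable {f}

omit [T2Space W] in
include hdisj in
/-- Distinct tubes have disjoint regions. [folklore] -/
theorem disjoint_tubeRegion {i j : ι} (hij : i ≠ j) (c c' : ℝ) :
    Disjoint ((f i).tubeRegion c) ((f j).tubeClosedRegion c') :=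
  Set.disjoint_of_subset ((f i).tubeRegion_subset_range c) ((f j).tubeClosedRegion_subset_range c')
    (hdisj hij)

include hdisj in
/-- A point of the range of `f i` has a neighbourhood missing the closed regions of the other
tubes (they are compact subsets of the other, disjoint, ranges). [folklore] -/
theorem eventually_not_mem_tubeClosedRegion [Finite ι] {i : ι} {z : W} (hz : z ∈ range (f i).toFun) (c : ℝ)
    (hc : 0 < c) : ∀ᶠ z' in 𝓝 z, ∀ j, j ≠ i → z' ∉ (f j).tubeClosedRegion c := by
  have h : ∀ j, j ≠ i → ∀ᶠ z' in 𝓝 z, z' ∉ (f j).tubeClosedRegion c := by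
    intro j hji
    have hzj : z ∉ (f j).tubeClosedRegion c := fun h =>
      Set.disjoint_left.1 (hdisj hji.symm) hz ((f j).tubeClosedRegion_subset_range c h)
    exact ((f j).isClosed_tubeClosedRegion hc).isOpen_compl.mem_nhds hzj
  refine eventually_all.2 fun j => ?_
  by_cases hji : j = i
  · exact Eventually.of_forall fun _ h' => absurd hji h'
  · filter_upwards [h j hji] with z' hz' _ using hz'

/-- **The data of a blend**: a reference boundary-defining function (smooth, nonnegative,
vanishing exactly on `∂W`, regular there) and cut-offs supported in the tubes. [folklore] -/
structure BlendData (f : ι → HandleAttachingMap 3 2 W) where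
  /-- the reference boundary-defining function -/
  f₀ : W → ℝ
  f₀_smooth : ContMDiff (𝓡∂ 4) 𝓘(ℝ, ℝ) ∞ f₀
  f₀_nonneg : ∀ z, 0 ≤ f₀ z
  f₀_eq_zero_iff : ∀ z, f₀ z = 0 ↔ z ∈ (𝓡∂ 4).boundary W
  f₀_regular : ∀ z, f₀ z = 0 → mfderiv (𝓡∂ 4) 𝓘(ℝ, ℝ) f₀ z ≠ 0
  /-- the cut-offs -/
  ρ : ι → W → ℝ
  ρ_smooth : ∀ i, ContMDiff (𝓡∂ 4) 𝓘(ℝ, ℝ) ∞ (ρ i)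
  ρ_mem : ∀ i z, ρ i z ∈ Icc (0 : ℝ) 1
  ρ_eq_one : ∀ i, ∀ z ∈ (f i).tubeClosedRegion (13 / 25), ρ i z = 1
  ρ_eq_zero : ∀ i z, z ∉ (f i).tubeRegion (51 / 100) → ρ i z = 0

variable (f) in
/-- **Blend data exist on a compact `W`** (reference function from `nonempty_flowoutInput`,
cut-offs from `exists_cutoff`). [folklore] -/
theorem nonempty_blendData [IsManifold (𝓡∂ 4) ∞ W] [CompactSpace W] : Nonempty (BlendData f) := by
  obtain ⟨D₀⟩ := nonempty_flowoutInput (n := 2) (M := W)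
  choose ρ hρs hρm hρ1 hρ0 using fun i => exists_cutoff f i
  refine ⟨⟨D₀.f, D₀.f_smooth, D₀.f_nonneg, D₀.f_eq_zero_iff, fun z hz h0 => ?_, ρ, hρs, hρm, hρ1, hρ0⟩⟩
  have h1 := D₀.mlineDeriv_f_ξ z (by rw [hz]; exact D₀.δ_pos.le)
  rw [mlineDeriv_def, h0] at h1
  have h1' : (0 : ℝ) = 1 := h1
  norm_num at h1'

namespace BlendData

variable (B : BlendData f)

section Basic

/-- **The blended boundary-defining function** `f_D = f₀ + Σᵢ ρᵢ (dᵢ - f₀)`, `dᵢ` the depth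
function of `f i`. [folklore] -/
def fD (z : W) : ℝ := B.f₀ z + ∑ᶠ i, B.ρ i z * ((f i).depthFun z - B.f₀ z)

/-- The `i`-th summand of the blend. [folklore] -/
def term (i : ι) (z : W) : ℝ := B.ρ i z * ((f i).depthFun z - B.f₀ z)

omit [T2Space W] in
/-- Unfolding the blend as a finite sum. [folklore] -/
theorem fD_eq (z : W) : B.fD z = B.f₀ z + ∑ᶠ i, B.term i z := rfl

omit [T2Space W] in
/-- The summand of a tube vanishes off its open region above `51/100`. [folklore] -/
theorem term_eq_zero {i : ι} {z : W} (hz : z ∉ (f i).tubeRegion (51 / 100)) : B.term i z = 0 := by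
  rw [term, B.ρ_eq_zero i z hz, zero_mul]

include hdisj in
/-- **The blend near a point of the range of `f i`**: there, only the `i`-th summand survives.
[folklore] -/
theorem fD_eventuallyEq [Finite ι] {i : ι} {z : W} (hz : z ∈ range (f i).toFun) :
    B.fD =ᶠ[𝓝 z] B.f₀ + B.term i := by
  haveI := Fintype.ofFinite ι
  filter_upwards [eventually_not_mem_tubeClosedRegion hdisj hz (51 / 100) (by norm_num)] with z' hz'
  rw [Pi.add_apply, fD_eq, finsum_eq_sum_of_fintype, Finset.sum_eq_single i]
  · intro j _ hji
    exact B.term_eq_zero fun h => hz' j hji ((f j).tubeRegion_subset_tubeClosedRegion _ h)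
  · exact fun h => absurd (Finset.mem_univ i) h

/-- **The blend off all closed regions above `51/100`** is the reference function. [folklore] -/
theorem fD_eventuallyEq_f₀ [Finite ι] {z : W} (hz : ∀ i, z ∉ (f i).tubeClosedRegion (51 / 100)) :
    B.fD =ᶠ[𝓝 z] B.f₀ := by
  haveI := Fintype.ofFinite ι
  have h : ∀ᶠ z' in 𝓝 z, ∀ i, z' ∉ (f i).tubeClosedRegion (51 / 100) := by
    refine eventually_all.2 fun i => ?_
    exact ((f i).isClosed_tubeClosedRegion (by norm_num)).isOpen_compl.mem_nhds (hz i)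
  filter_upwards [h] with z' hz'
  rw [fD_eq, finsum_eq_sum_of_fintype, Finset.sum_eq_zero, add_zero]
  intro j _
  exact B.term_eq_zero fun h => hz' j ((f j).tubeRegion_subset_tubeClosedRegion _ h)

/-- The summand of a tube is smooth (smooth on the range, zero near every other point).
[folklore] -/
theorem contMDiff_term [IsManifold (𝓡∂ 4) ∞ W] (i : ι) : ContMDiff (𝓡∂ 4) 𝓘(ℝ, ℝ) ∞ (B.term i) := by
  intro z
  by_cases hz : z ∈ range (f i).toFun
  · have h1 : ContMDiffAt (𝓡∂ 4) 𝓘(ℝ, ℝ) ∞ (f i).depthFun z :=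
      (f i).contMDiffOn_depthFun.contMDiffAt ((f i).isOpen_range.mem_nhds hz)
    exact ((B.ρ_smooth i) z).mul (h1.sub ((B.f₀_smooth) z))
  · -- off the compact closed region the summand vanishes identically
    have hzK : z ∉ (f i).tubeClosedRegion (51 / 100) := fun h =>
      hz ((f i).tubeClosedRegion_subset_range _ h)
    have hev : B.term i =ᶠ[𝓝 z] fun _ => 0 := by
      filter_upwards [((f i).isClosed_tubeClosedRegion (by norm_num)).isOpen_compl.mem_nhds hzK]
        with z' hz'
      exact B.term_eq_zero fun h => hz' ((f i).tubeRegion_subset_tubeClosedRegion _ h)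
    exact contMDiffAt_const.congr_of_eventuallyEq hev

/-- **The blend is smooth.** [folklore] -/
theorem contMDiff_fD [IsManifold (𝓡∂ 4) ∞ W] [Finite ι] : ContMDiff (𝓡∂ 4) 𝓘(ℝ, ℝ) ∞ B.fD := by
  haveI := Fintype.ofFinite ι
  have h : B.fD = fun z => B.f₀ z + ∑ i, B.term i z := by
    funext z; rw [fD_eq, finsum_eq_sum_of_fintype]
  rw [h]
  refine B.f₀_smooth.add ?_
  have := ContMDiff.sum (t := Finset.univ) (fun i _ => B.contMDiff_term i)
  simpa only [Finset.sum_apply] using this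

include hdisj in
/-- **Pointwise form of the blend**: at `z`, with `i` such that `z ∈ range (f i)`,
`f_D z = (1 - ρᵢ z) f₀ z + ρᵢ z dᵢ z`. [folklore] -/
theorem fD_apply_of_mem [Finite ι] {i : ι} {z : W} (hz : z ∈ range (f i).toFun) :
    B.fD z = (1 - B.ρ i z) * B.f₀ z + B.ρ i z * (f i).depthFun z := by
  rw [(B.fD_eventuallyEq hdisj hz).self_of_nhds, Pi.add_apply]
  unfold term
  ring

/-- Off all ranges the blend is the reference function. [folklore] -/
theorem fD_apply_of_not_mem [Finite ι] {z : W} (hz : ∀ i, z ∉ range (f i).toFun) : B.fD z = B.f₀ z :=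
  (B.fD_eventuallyEq_f₀ fun i h => hz i ((f i).tubeClosedRegion_subset_range _ h)).self_of_nhds

include hdisj in
/-- **The blend is nonnegative.** [folklore] -/
theorem fD_nonneg [Finite ι] (z : W) : 0 ≤ B.fD z := by
  by_cases h : ∃ i, z ∈ range (f i).toFun
  · obtain ⟨i, hz⟩ := h
    obtain ⟨y, rfl⟩ := hz
    rw [B.fD_apply_of_mem hdisj (mem_range_self y), depthFun_apply]
    have hρ := B.ρ_mem i ((f i).toFun y)
    have := B.f₀_nonneg ((f i).toFun y)
    have := tubeDepth_nonneg y
    nlinarith [hρ.1, hρ.2]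
  · push Not at h
    rw [B.fD_apply_of_not_mem h]
    exact B.f₀_nonneg z

include hdisj in
/-- **The blend vanishes exactly on `∂W`.** [folklore] -/
theorem fD_eq_zero_iff [Finite ι] (z : W) : B.fD z = 0 ↔ z ∈ (𝓡∂ 4).boundary W := by
  by_cases h : ∃ i, z ∈ range (f i).toFun
  · obtain ⟨i, hz⟩ := h
    obtain ⟨y, rfl⟩ := hz
    rw [B.fD_apply_of_mem hdisj (mem_range_self y)]
    have hρ := B.ρ_mem i ((f i).toFun y)
    have h0 := B.f₀_nonneg ((f i).toFun y)
    have hd := (f i).depthFun_nonneg ((f i).toFun y)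
    constructor
    · intro hsum
      by_cases hρ1 : B.ρ i ((f i).toFun y) = 1
      · rw [hρ1] at hsum
        have : (f i).depthFun ((f i).toFun y) = 0 := by linarith
        exact ((f i).depthFun_apply_eq_zero_iff y).1 this
      · have hlt : B.ρ i ((f i).toFun y) < 1 := lt_of_le_of_ne hρ.2 hρ1
        have h1 : (1 - B.ρ i ((f i).toFun y)) * B.f₀ ((f i).toFun y) = 0 := by
          nlinarith [hρ.1]
        have : B.f₀ ((f i).toFun y) = 0 := by
          rcases mul_eq_zero.1 h1 with h | h
          · linarith
          · exact h
        exact (B.f₀_eq_zero_iff _).1 this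
    · intro hb
      rw [(B.f₀_eq_zero_iff _).2 hb, ((f i).depthFun_apply_eq_zero_iff y).2 hb]
      ring
  · push Not at h
    rw [B.fD_apply_of_not_mem h]
    exact B.f₀_eq_zero_iff z

include hdisj in
/-- **On the open region above `13/25` of the tube of `f i` the blend is the depth function of
`f i`.** [folklore] -/
theorem fD_eq_depthFun [Finite ι] {i : ι} {z : W} (hz : z ∈ (f i).tubeRegion (13 / 25)) :
    B.fD z = (f i).depthFun z := by
  rw [B.fD_apply_of_mem hdisj ((f i).tubeRegion_subset_range _ hz),
    B.ρ_eq_one i z ((f i).tubeRegion_subset_tubeClosedRegion _ hz)]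
  ring

include hdisj in
/-- The blend agrees with the depth function of `f i` near every point of the open region above
`13/25`. [folklore] -/
theorem fD_eventuallyEq_depthFun [Finite ι] {i : ι} {z : W} (hz : z ∈ (f i).tubeRegion (13 / 25)) :
    B.fD =ᶠ[𝓝 z] (f i).depthFun := by
  filter_upwards [((f i).isOpen_tubeRegion _).mem_nhds hz] with z' hz'
  exact B.fD_eq_depthFun hdisj hz'

/-! ### Regularity of the blend along the boundary -/

include hdisj in
/-- **The blend is regular along `∂W`**: `d(f_D)_p ≠ 0` at every boundary point `p`.  Near `p`
the blend is `f₀ + ρᵢ (dᵢ - f₀)` (or `f₀`); at `p` both `f₀` and `dᵢ` vanish, have a local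
minimum and a nonzero differential, so `d(f_D)_p (e₀) = (1 - ρᵢ p) df₀(e₀) + ρᵢ p ddᵢ(e₀) > 0`
on the inward unit vector `e₀` (`mfderiv_inwardUnit_pos_of_isLocalMin`). [folklore] -/
theorem fD_regular [IsManifold (𝓡∂ 4) ∞ W] [Finite ι] {p : W} (hp : p ∈ (𝓡∂ 4).boundary W) :
    mfderiv (𝓡∂ 4) 𝓘(ℝ, ℝ) B.fD p ≠ 0 := by
  have hf₀p : B.f₀ p = 0 := (B.f₀_eq_zero_iff p).2 hp
  have hf₀d : MDifferentiableAt (𝓡∂ 4) 𝓘(ℝ, ℝ) B.f₀ p := B.f₀_smooth.mdifferentiableAt (by simp)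
  have hmin₀ : ∀ᶠ q in 𝓝 p, B.f₀ p ≤ B.f₀ q :=
    Eventually.of_forall fun q => by rw [hf₀p]; exact B.f₀_nonneg q
  have ha₀ : 0 < mlineDeriv (𝓡∂ 4) B.f₀ p (inwardUnit 3) :=
    mfderiv_inwardUnit_pos_of_isLocalMin hf₀d hmin₀ (B.f₀_regular p hf₀p)
  by_cases h : ∃ i, p ∈ range (f i).toFun
  · obtain ⟨i, hpi⟩ := h
    obtain ⟨y, rfl⟩ := hpi
    set p := (f i).toFun y with hp_def
    -- near `p` the blend is `f₀ + term i`
    have hev := B.fD_eventuallyEq hdisj (mem_range_self (f := (f i).toFun) y)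
    rw [hev.mfderiv_eq]
    have hdp : (f i).depthFun p = 0 := ((f i).depthFun_apply_eq_zero_iff y).2 hp
    have hdd : MDifferentiableAt (𝓡∂ 4) 𝓘(ℝ, ℝ) (f i).depthFun p :=
      ((f i).contMDiffOn_depthFun.contMDiffAt ((f i).isOpen_range.mem_nhds
        (mem_range_self y))).mdifferentiableAt (by simp)
    have hρd : MDifferentiableAt (𝓡∂ 4) 𝓘(ℝ, ℝ) (B.ρ i) p :=
      (B.ρ_smooth i).mdifferentiableAt (by simp)
    -- the three differentials, as linear forms on `T_pW`
    set L₀ : TangentSpace (𝓡∂ 4) p →L[ℝ] ℝ := mfderiv (𝓡∂ 4) 𝓘(ℝ, ℝ) B.f₀ p with hL₀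
    set Ld : TangentSpace (𝓡∂ 4) p →L[ℝ] ℝ := mfderiv (𝓡∂ 4) 𝓘(ℝ, ℝ) (f i).depthFun p with hLd
    set Lρ : TangentSpace (𝓡∂ 4) p →L[ℝ] ℝ := mfderiv (𝓡∂ 4) 𝓘(ℝ, ℝ) (B.ρ i) p with hLρ
    have H₀ : HasMFDerivAt (𝓡∂ 4) 𝓘(ℝ, ℝ) B.f₀ p L₀ := hf₀d.hasMFDerivAt
    have Hd : HasMFDerivAt (𝓡∂ 4) 𝓘(ℝ, ℝ) (f i).depthFun p Ld := hdd.hasMFDerivAt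
    have Hρ : HasMFDerivAt (𝓡∂ 4) 𝓘(ℝ, ℝ) (B.ρ i) p Lρ := hρd.hasMFDerivAt
    -- product rule: `d(ρᵢ (dᵢ - f₀))_p = ρᵢ p • (Ld - L₀)` since `dᵢ p = f₀ p = 0`
    have hterm : HasMFDerivAt (𝓡∂ 4) 𝓘(ℝ, ℝ) (B.term i) p (B.ρ i p • (Ld - L₀)) := by
      have h := Hρ.mul (Hd.sub H₀)
      have hzero : B.ρ i p • (Ld - L₀) + ((f i).depthFun - B.f₀) p • Lρ = B.ρ i p • (Ld - L₀) := by
        rw [Pi.sub_apply, hdp, hf₀p, sub_zero, zero_smul, add_zero]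
      rw [hzero] at h
      exact h
    have hsum : HasMFDerivAt (𝓡∂ 4) 𝓘(ℝ, ℝ) (B.f₀ + B.term i) p (L₀ + B.ρ i p • (Ld - L₀)) :=
      H₀.add hterm
    rw [hsum.mfderiv]
    -- evaluate on the inward unit vector
    intro h0
    have h1 : (L₀ + B.ρ i p • (Ld - L₀)) (inwardUnit 3) = (0 : ℝ) := by rw [h0]; rfl
    have h2 : (L₀ + B.ρ i p • (Ld - L₀)) (inwardUnit 3) =
        mlineDeriv (𝓡∂ 4) B.f₀ p (inwardUnit 3) + B.ρ i p *
          (mlineDeriv (𝓡∂ 4) (f i).depthFun p (inwardUnit 3) -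
            mlineDeriv (𝓡∂ 4) B.f₀ p (inwardUnit 3)) := rfl
    rw [h2] at h1
    have hρ := B.ρ_mem i p
    by_cases hρ0 : B.ρ i p = 0
    · rw [hρ0] at h1
      linarith
    · -- `ρᵢ p > 0`: then `p` lies in the open region above `51/100`, where `dᵢ` is regular
      have hpR : p ∈ (f i).tubeRegion (51 / 100) := by
        by_contra hc
        exact hρ0 (B.ρ_eq_zero i p hc)
      have hy : 1 / 2 < lamSq 2 (tubeVec y) := by
        have := ((f i).apply_mem_tubeRegion_iff).1 hpR; linarith
      have hmind : ∀ᶠ q in 𝓝 p, (f i).depthFun p ≤ (f i).depthFun q :=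
        Eventually.of_forall fun q => by rw [hdp]; exact (f i).depthFun_nonneg q
      have hdreg : mfderiv (𝓡∂ 4) 𝓘(ℝ, ℝ) (f i).depthFun p ≠ 0 := by
        intro h0'
        have h1' := (f i).mlineDeriv_depthFun_depthVF y hy
        rw [mlineDeriv_def, ← hp_def, h0'] at h1'
        have h1'' : (0 : ℝ) = 1 := h1'
        norm_num at h1''
      have had : 0 < mlineDeriv (𝓡∂ 4) (f i).depthFun p (inwardUnit 3) :=
        mfderiv_inwardUnit_pos_of_isLocalMin hdd hmind hdreg
      have hρpos : 0 < B.ρ i p := lt_of_le_of_ne hρ.1 (Ne.symm hρ0)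
      nlinarith [hρ.2]
  · push Not at h
    have hev := B.fD_eventuallyEq_f₀ fun i hz => h i ((f i).tubeClosedRegion_subset_range _ hz)
    rw [hev.mfderiv_eq]
    exact B.f₀_regular p hf₀p

/-! ### The adapted vector field -/

include hdisj in
/-- **The adapted vector field.**  For `δ > 0` such that `f_D` is regular on `{f_D < 2δ}`, there
is a smooth vector field `ξ` on `W` with `ξ(f_D) = 1` on `{f_D ≤ δ}` and `ξ = depthVF (f i)` on
the closed region above `11/20` of each tube (partition of unity over the depth fields near the
cores, local unit fields near the other points of `{f_D ≤ δ}`, and the zero field).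
[folklore] -/
theorem exists_field [IsManifold (𝓡∂ 4) ∞ W] [CompactSpace W] [Finite ι] {δ : ℝ} (hδ : 0 < δ)
    (hreg : ∀ z, B.fD z < 2 * δ → mfderiv (𝓡∂ 4) 𝓘(ℝ, ℝ) B.fD z ≠ 0) :
    ∃ ξ : (z : W) → TangentSpace (𝓡∂ 4) z,
      ContMDiff (𝓡∂ 4) ((𝓡∂ 4).prod 𝓘(ℝ, EuclideanSpace ℝ (Fin 4))) ∞
        (fun z => Bundle.TotalSpace.mk' (EuclideanSpace ℝ (Fin 4)) z (ξ z)) ∧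
      (∀ z, B.fD z ≤ δ → mlineDeriv (𝓡∂ 4) B.fD z (ξ z) = 1) ∧
      ∀ i, ∀ z ∈ (f i).tubeClosedRegion (11 / 20), ξ z = (f i).depthVF z := by
  haveI := Fintype.ofFinite ι
  -- the affine constraints
  set t : ∀ z : W, Set (TangentSpace (𝓡∂ 4) z) := fun z =>
    {v | (B.fD z ≤ δ → mlineDeriv (𝓡∂ 4) B.fD z v = 1) ∧
      ∀ i, z ∈ (f i).tubeClosedRegion (11 / 20) → v = (f i).depthVF z} with ht
  have hconv : ∀ z, Convex ℝ (t z) := by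
    intro z v hv w hw a b _ _ hab
    refine ⟨fun hz => ?_, fun i hz => ?_⟩
    · rw [mlineDeriv_def, map_add, map_smul, map_smul]
      change a • mlineDeriv (𝓡∂ 4) B.fD z v + b • mlineDeriv (𝓡∂ 4) B.fD z w = 1
      rw [hv.1 hz, hw.1 hz, smul_eq_mul, smul_eq_mul, mul_one, mul_one, hab]
    · rw [hv.2 i hz, hw.2 i hz, ← add_smul, hab, one_smul]
  -- local solutions
  have Hloc : ∀ z₀ : W, ∃ U ∈ 𝓝 z₀, ∃ s : (z : W) → TangentSpace (𝓡∂ 4) z,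
      ContMDiffOn (𝓡∂ 4) ((𝓡∂ 4).prod 𝓘(ℝ, EuclideanSpace ℝ (Fin 4))) ∞
        (fun z => Bundle.TotalSpace.mk' (EuclideanSpace ℝ (Fin 4)) z (s z)) U ∧
      ∀ z ∈ U, s z ∈ t z := by
    intro z₀
    by_cases hK : ∃ i, z₀ ∈ (f i).tubeClosedRegion (11 / 20)
    · -- near the core of `f i`: the depth field of `f i`
      obtain ⟨i, hz₀⟩ := hK
      have hz₀R : z₀ ∈ (f i).tubeRegion (13 / 25) :=
        (f i).tubeClosedRegion_subset_tubeRegion (by norm_num) hz₀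
      refine ⟨(f i).tubeRegion (13 / 25), ((f i).isOpen_tubeRegion _).mem_nhds hz₀R,
        (f i).depthVF, (f i).contMDiffOn_depthVF.mono ((f i).tubeRegion_subset_range _),
        fun z hz => ⟨fun _ => ?_, fun j hzj => ?_⟩⟩
      · -- `ξ(f_D) = ξ(dᵢ) = 1` on the open region (`f_D = dᵢ` there, `|x_λ|² > 1/2`)
        obtain ⟨y, hy, rfl⟩ := hz
        rw [mlineDeriv_def, (B.fD_eventuallyEq_depthFun hdisj ⟨y, hy, rfl⟩).mfderiv_eq]
        exact (f i).mlineDeriv_depthFun_depthVF y (by simp only [mem_setOf_eq] at hy; linarith)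
      · -- only `j = i` is possible
        by_contra _
        by_cases hji : j = i
        · subst hji; exact absurd rfl ‹¬_›
        · exact Set.disjoint_left.1 (disjoint_tubeRegion hdisj (Ne.symm hji) (13 / 25) (11 / 20))
            hz hzj
    · push Not at hK
      -- off the closed regions above `11/20`
      have hV : ∀ᶠ z in 𝓝 z₀, ∀ i, z ∉ (f i).tubeClosedRegion (11 / 20) := by
        refine eventually_all.2 fun i => ?_
        exact ((f i).isClosed_tubeClosedRegion (by norm_num)).isOpen_compl.mem_nhds (hK i)
      by_cases hle : B.fD z₀ < 2 * δ
      · -- a local unit field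
        obtain ⟨u, hu, s, hs, hs1⟩ :=
          exists_contMDiffOn_section_mlineDeriv_eq_one B.contMDiff_fD (hreg z₀ hle)
        obtain ⟨V, hVn, hVsub⟩ : ∃ V ∈ 𝓝 z₀, ∀ z ∈ V, ∀ i, z ∉ (f i).tubeClosedRegion (11 / 20) :=
          ⟨_, hV, fun z hz => hz⟩
        refine ⟨u ∩ V, inter_mem hu hVn, s, hs.mono inter_subset_left,
          fun z hz => ⟨fun _ => hs1 z hz.1, fun i hzi => absurd hzi (hVsub z hz.2 i)⟩⟩
      · -- the zero field on `{f_D > δ}`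
        push Not at hle
        have hO : ∀ᶠ z in 𝓝 z₀, δ < B.fD z :=
          B.contMDiff_fD.continuous.continuousAt.eventually (lt_mem_nhds (by linarith))
        obtain ⟨V, hVn, hVsub⟩ : ∃ V ∈ 𝓝 z₀, ∀ z ∈ V,
            (∀ i, z ∉ (f i).tubeClosedRegion (11 / 20)) ∧ δ < B.fD z :=
          ⟨_, hV.and hO, fun z hz => hz⟩
        refine ⟨V, hVn, fun _ => 0, ?_, fun z hz => ⟨fun hzδ => absurd hzδ (not_le.2 (hVsub z hz).2),
          fun i hzi => absurd hzi ((hVsub z hz).1 i)⟩⟩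
        exact (Bundle.contMDiff_zeroSection ℝ (TangentSpace (𝓡∂ 4) : W → Type _)).contMDiffOn
  obtain ⟨ξ, hξ⟩ := exists_contMDiffSection_forall_mem_convex_of_local (𝓡∂ 4)
    (TangentSpace (𝓡∂ 4) : W → Type _) t hconv Hloc
  exact ⟨ξ, ξ.contMDiff, fun z hz => (hξ z).1 hz, fun i z hz => (hξ z).2 i hz⟩

/-! ### The adapted flow-out input -/

include B hdisj in
/-- **Adapted flow-out input**: flow-out data `D` on the compact `W` whose function is the depth
function of `f i` and whose field is the depth field of `f i` on the closed region above
`11/20` of each tube. [cite: MilnorHCobordism1965, proof of Thm. 3.4] -/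
theorem exists_flowoutInput [IsManifold (𝓡∂ 4) ∞ W] [CompactSpace W] [Finite ι] :
    ∃ D : FlowoutInput 3 W, (∀ i, ∀ z ∈ (f i).tubeRegion (13 / 25), D.f z = (f i).depthFun z) ∧
      ∀ i, ∀ z ∈ (f i).tubeClosedRegion (11 / 20), D.ξ z = (f i).depthVF z := by
  obtain ⟨δ', hδ', hreg'⟩ := exists_pos_forall_mfderiv_ne_zero B.contMDiff_fD (B.fD_nonneg hdisj)
    fun z hz => B.fD_regular hdisj ((B.fD_eq_zero_iff hdisj z).1 hz)
  set δ := δ' / 2 with hδ_def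
  have hδ : 0 < δ := by positivity
  obtain ⟨ξ, hξs, hξ1, hξK⟩ := B.exists_field hdisj hδ fun z hz => hreg' z (by linarith)
  exact ⟨⟨B.fD, ξ, δ, hδ, B.contMDiff_fD, B.fD_nonneg hdisj, B.fD_eq_zero_iff hdisj, hξs, hξ1⟩,
    fun i z hz => B.fD_eq_depthFun hdisj hz, hξK⟩

end Basic

end BlendData

end Blend

/-! ### The adapted flow-out and the depth lines -/

section Adapted

variable [T2Space W] [IsManifold (𝓡∂ 4) ∞ W] [CompactSpace W] {ι : Type*} [Finite ι]

/-- **A flow-out of `∂W` adapted to a family of attaching maps.**  For a finite family `f` of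
attaching maps of 2-handles with pairwise disjoint ranges on the compact `W` there are flow-out
data `D` and a cover `Γ` (`BoundaryFlowout.lean`) such that the flow-out lines through the sphere
part of each tube near the attaching circle are the depth lines of `f i`:
`Γ.Fl (f i (depthLine θ v 0)) s = f i (depthLine θ v s)` for `‖v‖ ≤ 1/2` and
`0 ≤ s ≤ min (1/5) Γ.a` (the depth lines are integral curves of the depth field, which is `D.ξ`
on the closed region above `11/20`, and integral curves of `D.ξ` from a point are unique).
Kosinski (1993), VI §5 (collars adapted to imbeddings in the boundary); Milnor (1965), proof of
Thm. 3.4 (the collar as a flow-out). [cite: Kosinski1993, VI §5] -/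
theorem exists_adapted_flowout (f : ι → HandleAttachingMap 3 2 W)
    (hdisj : Pairwise fun i j => Disjoint (range (f i).toFun) (range (f j).toFun)) :
    ∃ (D : FlowoutInput 3 W) (Γ : D.Cover), ∀ (i : ι) (θ : 𝕊 1) (v : 𝔼 2), ‖v‖ ≤ 1 / 2 →
      ∀ s ∈ Icc (0 : ℝ) (min (1 / 5) Γ.a),
        Γ.Fl ((f i).toFun (depthLine θ v 0)) s = (f i).toFun (depthLine θ v s) := by
  obtain ⟨B⟩ := nonempty_blendData f
  obtain ⟨D, hDf, hDξ⟩ := B.exists_flowoutInput hdisj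
  obtain ⟨Γ⟩ := D.nonempty_cover
  refine ⟨D, Γ, fun i θ v hv s hs => ?_⟩
  set b := min (1 / 5 : ℝ) Γ.a with hb_def
  have hb5 : b ≤ 1 / 5 := min_le_left _ _
  have hba : b ≤ Γ.a := min_le_right _ _
  -- the starting point is a boundary point: `f_D = 0` there
  set z₀ := (f i).toFun (depthLine θ v 0) with hz₀
  have hz₀b : z₀ ∈ (𝓡∂ 4).boundary W := by
    rw [hz₀, (f i).apply_mem_boundary_iff]; exact norm_tubeVec_depthLine_zero θ v
  have hf0 : D.f z₀ = 0 := (D.f_eq_zero_iff z₀).2 hz₀b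
  -- the flow-out from `z₀` is an integral curve of `D.ξ` on `[0, b]`
  have h1 : IsMIntegralCurveOn (Γ.Fl z₀) D.ξ (Icc 0 b) := by
    have h := Γ.isMIntegralCurveOn_Fl (z := z₀) (by rw [hf0]; exact Γ.a_pos.le)
    rw [hf0, neg_zero] at h
    exact h.mono (Icc_subset_Icc le_rfl hba)
  -- the depth line is an integral curve of the depth field, which is `D.ξ` along it
  have hv2 : 1 / 2 ≤ 1 - 1 / 5 - ‖v‖ ^ 2 := by nlinarith [norm_nonneg v]
  have h2' := (f i).isMIntegralCurveOn_depthLine θ v (b := 1 / 5) hv2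
  have h2 : IsMIntegralCurveOn (fun s => (f i).toFun (depthLine θ v s)) D.ξ (Icc 0 b) := by
    intro t ht
    have ht' : t ∈ Icc (0 : ℝ) (1 / 5) := ⟨ht.1, ht.2.trans hb5⟩
    have h := (h2' t ht').mono (Icc_subset_Icc le_rfl hb5)
    have hmem := (f i).depthLine_mem_tubeClosedRegion θ hv ht'
    rw [← hDξ i _ hmem] at h
    exact h
  -- uniqueness
  have h0 : Γ.Fl z₀ 0 = (fun s => (f i).toFun (depthLine θ v s)) 0 := by
    show Γ.Fl z₀ 0 = (f i).toFun (depthLine θ v 0)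
    rw [Γ.Fl_zero (by rw [hf0]; exact Γ.a_pos.le)]
  exact D.eqOn_of_eq_left h1 h2 h0 hs

end Adapted

end HandleAttachingMap

end Literature.Topology.FourManifolds

end
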